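import Literature.NumberTheory.Transcendental.CurvePeriodsPathHomotopicProofs
import Literature.NumberTheory.Transcendental.CurvePeriodsPathCalculusProofs
import Literature.NumberTheory.Transcendental.CurvePeriodsGmLoopsProofs
import Mathlib.Analysis.Convex.Contractible
import Mathlib.Topology.Homotopy.Contractible
import Mathlib.AlgebraicTopology.FundamentalGroupoid.SimplyConnected
import HarnessLib

/-!
# `BetaLinearSector` (stmt-KontsevichZagierPeriods-3897), line `fermat-sector-transport` — stub
# `stub_sectorLoopInfinity` (H2: the loop in the chart at infinity is null-homotopic)

Pure topology behind the Cauchy-sector decomposition on the Fermat curve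
`F_N = {x^N + y^N = 1}`.  A set `S ⊆ ℂ` star-shaped at `0`, a function `Y` continuous on `S` with
`Φ(z) = (z, Y z) ∈ F_N`, and three `C¹` paths `γ₂`, `d₃`, `fI` on `F_N` lying on the chart `Φ`
over `S` (second coordinate `= Y` of the first, first coordinate in `S`) and forming the loop
`γ₂(1) = d₃(0) →d₃→ d₃(1) = fI(1) →fI⁻→ fI(0) = γ₂(0) →γ₂→ γ₂(1)` are given; then
`(d₃) − (fI) + (γ₂)` lies in the `ℚ̄`-span of the elementary relations (R1)–(R5) of
`Literature/NumberTheory/Transcendental/CurvePeriods.lean`.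

Proof: the `C¹` loop `L = d₃ ⋆ (fI⁻ ⋆ γ₂)` (`CurvePath.concat`, `CurvePath.reverse`) is
`Φ ∘ ℓ` for the planar loop `ℓ = ` first coordinate of `L`, a loop in the subspace `S`; `S` is
contractible (`StarConvex.contractibleSpace`), hence simply connected, so `ℓ` is homotopic to the
constant loop (`SimplyConnectedSpace.paths_homotopic`) and so is `L = Φ ∘ ℓ` in `F_N(ℂ)`
(`Path.Homotopic.map`).  By `span_single_of_nullhomotopic` the symbol of `L` is `∼ 0`, and
`span_concat`, `span_single_add_single_reverse` give `(L) ∼ (d₃) − (fI) + (γ₂)`.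

General lemmas (any curve): `span_single_of_simplyConnected_factor` (a `C¹` loop factoring through
a loop in a simply connected space has symbol `∼ 0`), `span_single_of_chartLoop` (the same for a
planar curve `Z ⊂ ℂ²`, a chart `z ↦ (z, Y z)` over a star-shaped set and a `C¹` loop on it),
`chartProp_reverse`, `chartProp_concat` (a pointwise property of the values on `[0,1]` passes to
reversals and concatenations).

References: A. Huber, G. Wüstholz, *Transcendence and Linear Relations of 1-Periods* (2022),
§3.3.1 (relative homology by smooth paths, homotopy invariance); B. Gross, *On the periods of
abelian integrals and a formula of Chowla and Selberg* (1978), §1 (with Rohrlich's appendix: the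
Fermat curve).  No definition, no named fact; the hypothesis `1 ≤ N` of the registered statement is
not used.
-/

noncomputable section

open scoped BigOperators unitInterval
open MeasureTheory Set MvPolynomial
open Literature.NumberTheory.Transcendental Literature.NumberTheory.Transcendental.CurvePeriods

namespace Summit.KontsevichZagierPeriods.FermatIsogeny.BetaLinearSector

/-! ## Pointwise properties of path values under reversal and concatenation -/

/-- A property of the values `γ(t)`, `t ∈ [0,1]`, passes to the reversed path `γ⁻(t) = γ(1 − t)`.
[folklore] -/
theorem chartProp_reverse {Z : CurveData} (P : (Fin Z.n → ℂ) → Prop) (γ : CurvePath Z)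
    (h : ∀ t ∈ Set.Icc (0:ℝ) 1, P (γ.toFun t)) :
    ∀ t ∈ Set.Icc (0:ℝ) 1, P (γ.reverse.toFun t) :=
  fun t ht => h (1 - t) (one_sub_mem_Icc ht)

/-- A property of the values on `[0,1]` of two paths passes to their `C¹` concatenation (which only
evaluates the pieces inside `[0,1]`, `smoothStep` mapping `[0,1]` to itself). [folklore] -/
theorem chartProp_concat {Z : CurveData} (P : (Fin Z.n → ℂ) → Prop) (γ₁ γ₂ : CurvePath Z)
    (hj : γ₁.toFun 1 = γ₂.toFun 0) (h₁ : ∀ t ∈ Set.Icc (0:ℝ) 1, P (γ₁.toFun t))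
    (h₂ : ∀ t ∈ Set.Icc (0:ℝ) 1, P (γ₂.toFun t)) :
    ∀ t ∈ Set.Icc (0:ℝ) 1, P ((γ₁.concat γ₂ hj).toFun t) := fun t ht => by
  rw [CurvePath.concat_apply]
  split_ifs with hle
  · exact h₁ _ (mapsTo_smoothStep (two_mul_mem_Icc ⟨ht.1, hle⟩))
  · exact h₂ _ (mapsTo_smoothStep (two_mul_sub_one_mem_Icc ⟨(not_le.mp hle).le, ht.2⟩))

/-! ## Loops factoring through a simply connected space -/

/-- **A `C¹` loop factoring through a loop in a simply connected space has symbol `∼ 0`.** If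
`Φ : K → Z(ℂ)` is continuous, `K` simply connected, `ℓ` a loop in `K` and the `C¹` loop `γ` on `Z`
agrees with `Φ ∘ ℓ` on `[0,1]`, then `(Z, ω, γ)` lies in the span of the elementary relations:
`ℓ ≃ const` (`SimplyConnectedSpace.paths_homotopic`), hence `Φ ∘ ℓ ≃ const` (`Path.Homotopic.map`),
and `span_single_of_nullhomotopic`. [cite: HuberWustholz2022, §3.3.1] -/
theorem span_single_of_simplyConnected_factor {Z : CurveData} (hZ : Z.IsSmoothAffineCurve)
    (ω : Fin Z.n → MvPolynomial (Fin Z.n) ℂ) (h : ∀ i, HasAlgCoeffs (ω i))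
    {K : Type*} [TopologicalSpace K] [SimplyConnectedSpace K] {Φ : K → Z.points}
    (hΦ : Continuous Φ) {k₀ : K} (ℓ : Path k₀ k₀) (γ : CurvePath Z)
    (hγ : ∀ t : I, γ.toFun t = Φ (ℓ t)) :
    ∃ (k : ℕ) (ρ : Fin k → (PeriodSymbol →₀ ℂ)) (a : Fin k → ℂ),
      (∀ l, IsElementaryRelation (ρ l)) ∧ (∀ l, IsAlgebraic ℚ (a l)) ∧
      Finsupp.single (⟨Z, hZ, ω, h, γ⟩ : PeriodSymbol) (1 : ℂ) = ∑ l, a l • ρ l := by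
  have hmap : (ℓ.map hΦ).Homotopic ((Path.refl k₀).map hΦ) :=
    (SimplyConnectedSpace.paths_homotopic ℓ (Path.refl k₀)).map ⟨Φ, hΦ⟩
  have hrefl : (Path.refl k₀).map hΦ = Path.refl (Φ k₀) := by
    ext t
    rfl
  rw [hrefl] at hmap
  exact span_single_of_nullhomotopic hZ ω h (ℓ.map hΦ) hmap γ (fun t => hγ t)

/-- **A `C¹` loop on a chart over a star-shaped planar set has symbol `∼ 0`.** Let `Z ⊂ ℂ²` be a
smooth affine plane curve, `S ⊆ ℂ` star-shaped at `0`, `Y` continuous on `S` with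
`(z, Y z) ∈ Z(ℂ)` for all `z`, and `L` a `C¹` loop on `Z` (`L(1) = L(0)`) whose values on `[0,1]` are
`(L₀(t), Y(L₀(t)))` with `L₀(t) ∈ S`. Then `(Z, ω, L)` lies in the span of the elementary relations:
`S` is contractible (`StarConvex.contractibleSpace`), hence simply connected, and `L = Φ ∘ L₀` with
`Φ(z) = (z, Y z)` continuous on `S` (`span_single_of_simplyConnected_factor`).
[cite: HuberWustholz2022, §3.3.1] -/
theorem span_single_of_chartLoop {m : ℕ} {Fs : Fin m → MvPolynomial (Fin 2) ℂ}
    (hZ : (⟨2, m, Fs⟩ : CurveData).IsSmoothAffineCurve)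
    (ω : Fin 2 → MvPolynomial (Fin 2) ℂ) (h : ∀ i, HasAlgCoeffs (ω i))
    {S : Set ℂ} (hS : StarConvex ℝ (0 : ℂ) S) {Y : ℂ → ℂ} (hYc : ContinuousOn Y S)
    (hmem : ∀ z : ℂ, (![z, Y z] : Fin 2 → ℂ) ∈ (⟨2, m, Fs⟩ : CurveData).points)
    (L : CurvePath (⟨2, m, Fs⟩ : CurveData))
    (hL : ∀ t ∈ Set.Icc (0:ℝ) 1, L.toFun t = ![L.toFun t 0, Y (L.toFun t 0)] ∧ L.toFun t 0 ∈ S)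
    (hloop : L.toFun 1 = L.toFun 0) :
    ∃ (k : ℕ) (ρ : Fin k → (PeriodSymbol →₀ ℂ)) (a : Fin k → ℂ),
      (∀ l, IsElementaryRelation (ρ l)) ∧ (∀ l, IsAlgebraic ℚ (a l)) ∧
      Finsupp.single (⟨(⟨2, m, Fs⟩ : CurveData), hZ, ω, h, L⟩ : PeriodSymbol) (1 : ℂ) =
        ∑ l, a l • ρ l := by
  have h0 : (0 : ℝ) ∈ Set.Icc (0:ℝ) 1 := ⟨le_rfl, zero_le_one⟩
  -- the star-shaped set `S` is contractible, hence simply connected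
  haveI : ContractibleSpace S := hS.contractibleSpace ⟨L.toFun 0 0, (hL 0 h0).2⟩
  -- the chart `Φ(z) = (z, Y z)` as a continuous map `S → Z(ℂ)`
  let Φ : S → (⟨2, m, Fs⟩ : CurveData).points := fun z => ⟨![(z : ℂ), Y z], hmem z⟩
  have hY' : Continuous fun z : S => Y (z : ℂ) :=
    hYc.comp_continuous continuous_subtype_val fun z => z.2
  have hΦ : Continuous Φ :=
    (continuous_subtype_val.matrixVecCons (hY'.matrixVecCons continuous_const)).subtype_mk _
  -- the planar loop `ℓ = L₀` in `S`
  let k₀ : S := ⟨L.toFun 0 0, (hL 0 h0).2⟩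
  have hLc : Continuous fun t : I => L.toFun t 0 :=
    (continuous_apply 0).comp
      (L.contDiffOn.continuousOn.comp_continuous continuous_subtype_val fun t => t.2)
  let ℓ : Path k₀ k₀ :=
    { toFun := fun t => ⟨L.toFun t 0, (hL t t.2).2⟩
      continuous_toFun := hLc.subtype_mk _
      source' := rfl
      target' := Subtype.ext (congrFun hloop 0) }
  exact span_single_of_simplyConnected_factor hZ ω h hΦ ℓ L fun t => (hL t t.2).1

/-! ## The registered stub -/

/-- SECTOR STUB H2 (the loop in the chart at infinity is null-homotopic ⇒ its symbol is `∼ 0`).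
Pure topology: if `Y` is continuous on a set `S ⊆ ℂ` star-shaped at `0` with
`Φ(z) = (z, Y z) ∈ F_N`, and three `C¹` paths `γ₂, d₃, fI` on `F_N` lie on the chart over `S`
(second coordinate `= Y` of the first, first coordinate in `S`) and form the loop
`γ₂(1) = d₃(0) →d₃→ d₃(1) = fI(1) →fI⁻→ fI(0) = γ₂(0) →γ₂→ γ₂(1)`, then `(d₃) − (fI) + (γ₂) ∼ 0`:
the `C¹` loop `d₃ ⋆ (fI⁻ ⋆ γ₂)` is `Φ ∘ (planar loop in S)`, `S` is contractible
(`StarConvex.contractibleSpace`), so the loop is null-homotopic in `F_N(ℂ)` (`Path.Homotopic.map`)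
and `span_single_of_nullhomotopic`, `span_concat`, `span_single_add_single_reverse` conclude.
[cite: HuberWustholz2022, §3.3.1] -/
theorem stub_sectorLoopInfinity : ∀ (N : ℕ), 1 ≤ N → ∀ (S : Set ℂ), StarConvex ℝ (0 : ℂ) S →
    ContinuousOn (fun z : ℂ => Complex.exp (-(↑Real.pi * Complex.I / (2 * (N : ℂ)))) * (Complex.I * (1 - z ^ N)) ^ ((N : ℂ)⁻¹)) S →
    (∀ z : ℂ, (![z, Complex.exp (-(↑Real.pi * Complex.I / (2 * (N : ℂ)))) * (Complex.I * (1 - z ^ N)) ^ ((N : ℂ)⁻¹)] :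
        Fin 2 → ℂ) ∈ (⟨2, 1, ![X 0 ^ N + X 1 ^ N - 1]⟩ : CurveData).points) →
    ∀ (hZ : (⟨2, 1, ![X 0 ^ N + X 1 ^ N - 1]⟩ : CurveData).IsSmoothAffineCurve)
      (ω : Fin 2 → MvPolynomial (Fin 2) ℂ) (hω : ∀ i, HasAlgCoeffs (ω i))
      (γ₂ d₃ f' : CurvePath (⟨2, 1, ![X 0 ^ N + X 1 ^ N - 1]⟩ : CurveData)),
    (∀ t ∈ Set.Icc (0:ℝ) 1, γ₂.toFun t = ![γ₂.toFun t 0, Complex.exp (-(↑Real.pi * Complex.I / (2 * (N : ℂ)))) *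
        (Complex.I * (1 - (γ₂.toFun t 0) ^ N)) ^ ((N : ℂ)⁻¹)] ∧ γ₂.toFun t 0 ∈ S) →
    (∀ t ∈ Set.Icc (0:ℝ) 1, d₃.toFun t = ![d₃.toFun t 0, Complex.exp (-(↑Real.pi * Complex.I / (2 * (N : ℂ)))) *
        (Complex.I * (1 - (d₃.toFun t 0) ^ N)) ^ ((N : ℂ)⁻¹)] ∧ d₃.toFun t 0 ∈ S) →
    (∀ t ∈ Set.Icc (0:ℝ) 1, f'.toFun t = ![f'.toFun t 0, Complex.exp (-(↑Real.pi * Complex.I / (2 * (N : ℂ)))) *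
        (Complex.I * (1 - (f'.toFun t 0) ^ N)) ^ ((N : ℂ)⁻¹)] ∧ f'.toFun t 0 ∈ S) →
    d₃.toFun 0 = γ₂.toFun 1 → d₃.toFun 1 = f'.toFun 1 → f'.toFun 0 = γ₂.toFun 0 →
    ∃ (k : ℕ) (ρ : Fin k → (PeriodSymbol →₀ ℂ)) (a : Fin k → ℂ),
      (∀ l, IsElementaryRelation (ρ l)) ∧ (∀ l, IsAlgebraic ℚ (a l)) ∧
      (Finsupp.single (⟨(⟨2, 1, ![X 0 ^ N + X 1 ^ N - 1]⟩ : CurveData), hZ, ω, hω, d₃⟩ : PeriodSymbol) (1 : ℂ) -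
          Finsupp.single (⟨(⟨2, 1, ![X 0 ^ N + X 1 ^ N - 1]⟩ : CurveData), hZ, ω, hω, f'⟩ : PeriodSymbol) (1 : ℂ) +
          Finsupp.single (⟨(⟨2, 1, ![X 0 ^ N + X 1 ^ N - 1]⟩ : CurveData), hZ, ω, hω, γ₂⟩ : PeriodSymbol) (1 : ℂ)) =
        ∑ l, a l • ρ l := by
  intro N _ S hS hYc hmem hZ ω hω γ₂ d₃ f' hγ₂ hd₃ hf' h₁ h₂ h₃
  -- the `C¹` loop `L = d₃ ⋆ (fI⁻ ⋆ γ₂)` at `γ₂(1)`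
  have hj₂ : f'.reverse.toFun 1 = γ₂.toFun 0 := by
    show f'.toFun (1 - 1) = γ₂.toFun 0
    rw [sub_self, h₃]
  have hj₁ : d₃.toFun 1 = (f'.reverse.concat γ₂ hj₂).toFun 0 := by
    rw [CurvePath.concat_zero]
    show d₃.toFun 1 = f'.toFun (1 - 0)
    rw [sub_zero, h₂]
  -- its values on `[0,1]` lie on the chart over `S`, and it is closed
  have hL := chartProp_concat
    (fun v : Fin 2 → ℂ => v = ![v 0, Complex.exp (-(↑Real.pi * Complex.I / (2 * (N : ℂ)))) *
      (Complex.I * (1 - (v 0) ^ N)) ^ ((N : ℂ)⁻¹)] ∧ v 0 ∈ S)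
    d₃ (f'.reverse.concat γ₂ hj₂) hj₁ hd₃ (chartProp_concat _ f'.reverse γ₂ hj₂
      (chartProp_reverse _ f' hf') hγ₂)
  have hloop : (d₃.concat (f'.reverse.concat γ₂ hj₂) hj₁).toFun 1 =
      (d₃.concat (f'.reverse.concat γ₂ hj₂) hj₁).toFun 0 := by
    rw [CurvePath.concat_one, CurvePath.concat_one, CurvePath.concat_zero, h₁]
  -- hence its symbol is `∼ 0`
  have hnull := span_single_of_chartLoop hZ ω hω hS hYc hmem
    (d₃.concat (f'.reverse.concat γ₂ hj₂) hj₁) hL hloop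
  -- bookkeeping: `(L) ∼ (d₃) + (fI⁻ ⋆ γ₂) ∼ (d₃) + (fI⁻) + (γ₂) ∼ (d₃) − (fI) + (γ₂)`
  have hc₁ := span_concat hZ ω hω d₃ (f'.reverse.concat γ₂ hj₂) hj₁
  have hc₂ := span_concat hZ ω hω f'.reverse γ₂ hj₂
  have hr := span_single_add_single_reverse hZ ω hω f'
  obtain ⟨k, ρ, a, hρ, ha, he⟩ := span_sub (span_sub (span_sub hnull hc₁) hc₂) hr
  exact ⟨k, ρ, a, hρ, ha, by rw [← he]; abel⟩

end Summit.KontsevichZagierPeriods.FermatIsogeny.BetaLinearSector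

end
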